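import Summits.CriticalPhenomena.PercolationContinuityZ3.Theorems.SahiMasterFamilyBilin

/-!
# SDH♭(8), SDH♭-LIN(8) and BILIN(8) are FALSE: the bi-principal counterexample, checked in the kernel

Unit `prim-masterthm-p4` (gen 20; crux anchor stmt-CriticalPhenomena-4575, helper work; memo
`run/shared/lean/prim/prim-masterthm/prim-masterthm-p4/SDH8-REFUTATION.md` (gen 19) and `P4-GEN20-REPORT.md` §1).
Companion of `…SahiMasterFamilySDHFlat` (the typed conjecture `SDHFlat.SDHFlatNonneg k` = SDH♭(k): `Λ(𝒢, β) ≥ 0` for every union-closed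
`𝒢 ∋ univ` and every point `β` of the union-closed hull), `…HFlatLin` (`SDHFlat.SDHFlatLin k`, `sdhFlatNonneg_of_sdhFlatLin`) and `…Bilin`
(`SDHFlat.Bilin k`, `sdhFlatLin_of_bilin`; kernel `k ≤ 5` in `…BilinFiveKernel`).

**THEOREM (this file).** `not_sdhFlatNonneg_eight : ¬ SDHFlatNonneg 8`, hence `not_sdhFlatLin_eight : ¬ SDHFlatLin 8` and
`not_bilin_eight : ¬ Bilin 8`.  WITNESS (gen 19, exact): `k = 8`, blocks `B₁ = {0,1,2,3}`, `B₂ = {4,5,6,7}`, the BI-PRINCIPAL hull point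
`β = ½·1_{𝒰₁} + ½·1_{𝒰₂}` with `𝒰_i = {∅ ≠ S ⊆ B_i} ∪ {univ}` (union-closed, contain `univ`), against the union-closed family
`𝒢 = {S : 3 ∉ S} ∪ {S ⊇ B₁} ∪ {S ⊇ B₂} ∋ univ`:  **`Λ(𝒢, β) = −3105/64 < 0`**.  (At the same point `Φ_8`, H♯ and H♭ are positive: the DIAGONAL
statements survive, the DECOUPLED ones — one union-closed family against a FOREIGN hull point — die at `k = 8`; they are kernel theorems for
`k ≤ 5`, `…BilinFiveKernel`.)

METHOD (proof by reflection).  Exact rational mirrors of the three ingredients of `Λ`: `phiSetQ` (the cycle form of `Φ`,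
`PhiVertex.phiSet_eq_sum_perm`), `blockCoefQ` (the block coefficient `κ_B(β) = coRest (realW β) realF B` is by definition a signed cycle sum over
the permutations of `Bᶜ`, `PrincipalCapBeta.ex_realW_prod`), `lamQ`; cast lemmas `phiSet = ↑phiSetQ`, `blockCoef = ↑blockCoefQ`,
`lam = ↑lamQ` at rational points; the value `lamQ 𝒢 β = −3105/64` and the finitely many closure facts by `native_decide` (a COMPUTATIONAL
file: the evaluation runs over the `8! = 40320` permutations of `Fin 8` and the permutations of every complement `Bᶜ`, `B ∈ 𝒢`).
HONEST FRAMING: three typed conjectures refuted at `k = 8` (they remain theorems for `k ≤ 5` and numerically open at `k = 6, 7`); H♭, H♯,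
(UC-hull)_k (k ≥ 8), Sahi's `C_k`, Kahn's Conjecture 5 and the master theorem remain OPEN.  Axioms standard + `Lean.ofReduceBool`
(`native_decide`). [this work]
-/

namespace Summit.CriticalPhenomena.PercolationContinuityZ3.Theorems

namespace SDHFlatEight

open Finset
open Literature.Combinatorics.Sahi2008
open PrincipalCapBeta (phiSet realW realF ex_realW_prod)
open SDHFlat (blockCoef hyb lam SDHFlatNonneg SDHFlatLin Bilin)

variable {k : ℕ}

/-! ### Exact rational mirrors of `Φ`, `κ_B` and `Λ` -/

/-- `Φ_{n+1}` over `ℚ` in cycle form: `Σ_σ (−1)^{#cycles − 1} ∏_{c ∈ cycles σ} q(c)`. [this work] -/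
def phiSetQ (n : ℕ) (q : Finset (Fin (n + 1)) → ℚ) : ℚ :=
  ∑ σ : Equiv.Perm (Fin (n + 1)), (-1 : ℚ) ^ ((CycleForm.orbits σ).card - 1) * ∏ B ∈ CycleForm.orbits σ, q B

/-- `Φ_{n+1}` at a rational point is the cast of `phiSetQ` (cycle form `PhiVertex.phiSet_eq_sum_perm`). [this work] -/
theorem phiSet_eq_cast_phiSetQ (n : ℕ) (q : Finset (Fin (n + 1)) → ℚ) :
    phiSet (n + 1) (fun S => (q S : ℝ)) = ((phiSetQ n q : ℚ) : ℝ) := by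
  rw [PhiVertex.phiSet_eq_sum_perm, phiSetQ]
  push_cast
  rfl

/-- The block coefficient `κ_B` over `ℚ`: `Σ_{τ ∈ Sym(Bᶜ)} (−1)^{#cycles τ} ∏_{c ∈ cycles τ} q(c)` (the definition of `coRest` read at a
rational point). [this work] -/
def blockCoefQ (q : Finset (Fin k) → ℚ) (B : Finset (Fin k)) : ℚ :=
  ∑ τ : Equiv.Perm {x // x ∉ B}, (-1 : ℚ) ^ (CycleForm.orbits τ).card *
    ∏ O ∈ CycleForm.orbits τ, q (O.map (Function.Embedding.subtype _))

/-- `κ_B` at a rational point is the cast of `blockCoefQ`. [this work] -/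
theorem blockCoef_eq_cast_blockCoefQ (q : Finset (Fin k) → ℚ) (B : Finset (Fin k)) :
    blockCoef (fun S => (q S : ℝ)) B = ((blockCoefQ q B : ℚ) : ℝ) := by
  unfold SDHFlat.blockCoef CycleForm.coRest CycleForm.cycleE blockCoefQ
  push_cast
  refine sum_congr rfl fun τ _ => ?_
  congr 1
  refine prod_congr rfl fun O _ => ?_
  have e2 : (fun x => ∏ i ∈ O, realF ((i : {x // x ∉ B}) : Fin k) x) =
      ∏ j ∈ O.map (Function.Embedding.subtype _), (realF j : Finset (Fin k) → ℝ) := by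
    funext x
    rw [Finset.prod_apply, prod_map]
    rfl
  rw [e2, ex_realW_prod]

/-- `Λ(𝒢, ·)` over `ℚ`, in the shape of Identity 2.2 (`SDHFlat.lam_eq_sum_caps_sub_sum_sdiff`: `Λ` only sees the sets OUTSIDE `𝒢`):
`Σ_{t : {t} ∉ 𝒢} Φ(cap_t q) − Σ_{B ∉ 𝒢} |B|·(|B|−1)!·κ_B(q)` — so that only the capped functionals at singletons outside `𝒢` are evaluated. [this work] -/
def lamQ (𝒢 : Finset (Finset (Fin (k + 1)))) (q : Finset (Fin (k + 1)) → ℚ) : ℚ :=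
  (∑ t ∈ (univ : Finset (Fin (k + 1))).filter (fun t => ({t} : Finset (Fin (k + 1))) ∉ 𝒢),
      phiSetQ k (fun S => if t ∈ S then 1 else q S))
    - ∑ B ∈ univ \ 𝒢, ((B.card : ℚ) * ((B.card - 1).factorial : ℚ)) * blockCoefQ q B

/-- `Λ(𝒢, β)` at a rational point is the cast of `lamQ` (Identity 2.2 and the two cast lemmas). [this work] -/
theorem lam_eq_cast_lamQ (𝒢 : Finset (Finset (Fin (k + 1)))) (q : Finset (Fin (k + 1)) → ℚ) :
    lam 𝒢 (fun S => (q S : ℝ)) = ((lamQ 𝒢 q : ℚ) : ℝ) := by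
  have hcap : ∀ t : Fin (k + 1), (fun S : Finset (Fin (k + 1)) => if t ∈ S then (1 : ℝ) else (q S : ℝ)) =
      fun S => (((if t ∈ S then (1 : ℚ) else q S : ℚ)) : ℝ) := by
    intro t; funext S; split_ifs <;> simp
  rw [SDHFlat.lam_eq_sum_caps_sub_sum_sdiff, lamQ]
  have h1 : (∑ t : Fin (k + 1), (if ({t} : Finset (Fin (k + 1))) ∈ 𝒢 then (0 : ℝ) else 1) *
        phiSet (k + 1) (fun S => if t ∈ S then 1 else (q S : ℝ))) =
      ∑ t ∈ (univ : Finset (Fin (k + 1))).filter (fun t => ({t} : Finset (Fin (k + 1))) ∉ 𝒢),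
        ((phiSetQ k (fun S => if t ∈ S then 1 else q S) : ℚ) : ℝ) := by
    rw [sum_filter]
    refine sum_congr rfl fun t _ => ?_
    rw [hcap t, phiSet_eq_cast_phiSetQ]
    split_ifs <;> simp
  have h2 : ∑ B ∈ univ \ 𝒢, ((B.card : ℝ) * ((B.card - 1).factorial : ℝ)) * blockCoef (fun S => (q S : ℝ)) B =
      ∑ B ∈ univ \ 𝒢, ((((B.card : ℚ) * ((B.card - 1).factorial : ℚ)) * blockCoefQ q B : ℚ) : ℝ) := by
    refine sum_congr rfl fun B _ => ?_
    rw [blockCoef_eq_cast_blockCoefQ]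
    push_cast
    ring
  rw [h1, h2]
  push_cast
  ring

/-! ### The witness at `k = 8` -/

/-- The first block `B₁ = {0,1,2,3}`. [this work] -/
def blk1 : Finset (Fin 8) := {0, 1, 2, 3}

/-- The second block `B₂ = {4,5,6,7}`. [this work] -/
def blk2 : Finset (Fin 8) := {4, 5, 6, 7}

/-- The principal family of a block: its nonempty subsets, plus `univ`. [this work] -/
def prin (b : Finset (Fin 8)) : Finset (Finset (Fin 8)) :=
  univ.filter fun S => (S.Nonempty ∧ S ⊆ b) ∨ S = univ

/-- The two families of the bi-principal mixture. [this work] -/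
def famU : Fin 2 → Finset (Finset (Fin 8)) := ![prin blk1, prin blk2]

/-- The foreign family `𝒢 = {S : 3 ∉ S} ∪ {S ⊇ B₁} ∪ {S ⊇ B₂}`. [this work] -/
def famG : Finset (Finset (Fin 8)) :=
  univ.filter fun S => (3 : Fin 8) ∉ S ∨ blk1 ⊆ S ∨ blk2 ⊆ S

/-- The bi-principal point `β = ½·1_{𝒰₁} + ½·1_{𝒰₂}` over `ℚ`. [this work] -/
def qβ : Finset (Fin 8) → ℚ := fun S =>
  (1 / 2 : ℚ) * (if S ∈ prin blk1 then 1 else 0) + (1 / 2 : ℚ) * (if S ∈ prin blk2 then 1 else 0)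

/-- **The value of the witness: `Λ(𝒢, β) = −3105/64`** (exact evaluation, `native_decide`). [this work] -/
theorem lamQ_famG_qβ : lamQ famG qβ = -3105 / 64 := by
  native_decide

/-- The two principal families are closed under unions. [this work] -/
theorem famU_unionClosed : ∀ x : Fin 2, ∀ A ∈ famU x, ∀ A' ∈ famU x, A ∪ A' ∈ famU x := by
  native_decide

/-- The two principal families contain `univ`. [this work] -/
theorem famU_top : ∀ x : Fin 2, (univ : Finset (Fin 8)) ∈ famU x := by
  native_decide

/-- `𝒢` is closed under unions. [this work] -/
theorem famG_unionClosed : ∀ A ∈ famG, ∀ A' ∈ famG, A ∪ A' ∈ famG := by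
  native_decide

/-- `𝒢` contains `univ`. [this work] -/
theorem famG_top : (univ : Finset (Fin 8)) ∈ famG := by
  native_decide

/-- The mixture with weights `½, ½` of the indicators of `famU` is (the cast of) `qβ`. [this work] -/
theorem mixture_eq_qβ :
    (fun S : Finset (Fin 8) => ∑ x : Fin 2, (1 / 2 : ℝ) * (if S ∈ famU x then (1 : ℝ) else 0)) = fun S => ((qβ S : ℚ) : ℝ) := by
  funext S
  simp only [Fin.sum_univ_two, famU, qβ, Matrix.cons_val_zero, Matrix.cons_val_one]
  push_cast
  split_ifs <;> norm_num

/-- **SDH♭(8) is false.** [this work] -/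
theorem not_sdhFlatNonneg_eight : ¬ SDHFlatNonneg 8 := by
  intro h
  have h0 := h (Fin 2) (fun _ => (1 / 2 : ℝ)) famU (fun _ => by norm_num) (by norm_num [Fin.sum_univ_two])
    famU_unionClosed famU_top famG famG_unionClosed famG_top
  rw [mixture_eq_qβ, lam_eq_cast_lamQ, lamQ_famG_qβ] at h0
  norm_num at h0

/-- **SDH♭-LIN(8) is false** (it implies SDH♭(8)). [this work] -/
theorem not_sdhFlatLin_eight : ¬ SDHFlatLin 8 := fun h =>
  not_sdhFlatNonneg_eight (SDHFlat.sdhFlatNonneg_of_sdhFlatLin h)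

/-- **BILIN(8) is false** (it implies SDH♭-LIN(8)). [this work] -/
theorem not_bilin_eight : ¬ Bilin 8 := fun h =>
  not_sdhFlatLin_eight (SDHFlat.sdhFlatLin_of_bilin h)

end SDHFlatEight

end Summit.CriticalPhenomena.PercolationContinuityZ3.Theorems
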